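import Literature.Geometry.ComplexAnalytic.RelativeExponentialChartLocal
import HarnessLib

/-!
# Gluing relative exponential charts whose fibre data are RIGID: local charts with a unique pointwise normal form give ONE chart over `U`
# ([BirkenhakeLange2004] Ch. 8 §8.7; [Milne2005ShimuraVarieties] §6 Thm. 6.11 (rigidity of marked triples, lemma of Serre); [Shimura1963AnalyticFamilies] §2)

Layer `Literature/Geometry/ComplexAnalytic`, namespace `Literature.Geometry.ComplexAnalytic.IsRelExpChartOn`.  THEOREMS ONLY (no definition,
no named fact, no instance, no notation, no `sorry`).  Cell `hodgecm-mathlib` (D-0151), FLOOR 0, P6 «MOD» (crux hLiu418 =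
stmt-HodgeConjecture-24832, `--supports`), half A line L7, socket `stub_UNIVFAM` (printed letter P-3 «UNIV-FAMILY» ★
`siegelUniversalFamilyUniformisation`), organ O6 «GLUE» of `StubUNIVFAM.closer.skeleton.v1` (LA7-plan deal v1, 2026-09-02), GENERIC HALF:
the P-3-specific half only has to say that the pointwise normal form «period family `= Π_{s t}`, (G), (ADM) with `γ = 1`, `Ψ = Π_{s t}`,
torus map = fibre map» is RIGID (★ `SiegelAdelicMarking.toFun_eq_toFun_of_lifts` + injectivity of `fibrePointToLeft` and of the
analytification `φA`).  HC_CM is proved only modulo the printed citations until rung 0 closes; this file is generic and changes no count.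

THE MATHEMATICS.  Let `Q b Φ_b f` be any property of the FIBRE DATUM of a chart at `b` — its period isomorphism `Φ_b : ℝ^ι ≃ E` and its fibre
map `f = ex (b, ·) : E → M` — which is RIGID on `U`: two fibre data at `b ∈ U` with `Q` are equal.  If every `b ∈ U` has an open `V ∋ b`,
`V ⊆ U`, and a chart over `V` all of whose fibre data satisfy `Q`, then there is ONE chart `(Φ, ex)` over `U` all of whose fibre data satisfy
`Q` (`exists_chart_of_local_of_rigid`): choose a chart at every point of `U`, define `(Φ, ex)` pointwise from the chart chosen AT THAT POINT,
and observe that any of the local charts agrees with `(Φ, ex)` on its domain by rigidity, so ★ `IsRelExpChartOn.of_local` applies.  In print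
this is how the universal marked family over (an evenly covered open of) the Siegel modular variety is assembled from local markings, the
rigidity being [Milne2005ShimuraVarieties] Thm. 6.11 with the lemma of Serre (`N ≥ 3`): a marked polarised abelian variety with level
structure has no automorphisms, so THE marking is unique ([BirkenhakeLange2004] §8.7; [Shimura1963AnalyticFamilies] §2).

## References
* [BirkenhakeLange2004] C. Birkenhake, H. Lange, *Complex Abelian Varieties*, 2nd ed. (2004), Ch. 8 §8.7.
* [Milne2005ShimuraVarieties] J. S. Milne, *Introduction to Shimura Varieties* (2005), §6 Thm. 6.11 p. 74 (and the lemma of Serre).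
* [Shimura1963AnalyticFamilies] G. Shimura, *On analytic families of polarized abelian varieties and automorphic functions*, Ann. Math. 78
  (1963), §2.
-/

set_option autoImplicit false

noncomputable section

open scoped Manifold Topology
open Set

namespace Literature.Geometry.ComplexAnalytic.IsRelExpChartOn

variable {EB : Type*} [NormedAddCommGroup EB] [NormedSpace ℂ EB] {B : Type*} [TopologicalSpace B] [ChartedSpace EB B]
  {E : Type*} [NormedAddCommGroup E] [NormedSpace ℂ E] {ι : Type*}
  {EM : Type*} [NormedAddCommGroup EM] [NormedSpace ℂ EM] {M : Type*} [TopologicalSpace M] [ChartedSpace EM M]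
  {p : M → B} {U : Set B}

/-- **GLUING CHARTS WITH RIGID FIBRE DATA**: let `Q b Φ_b f` be a property of fibre data (period isomorphism `Φ_b`, fibre map `f : E → M`)
which is RIGID on `U` (`Q b Φ₁ f₁ → Q b Φ₂ f₂ → Φ₁ = Φ₂ ∧ f₁ = f₂` for `b ∈ U`).  If every `b ∈ U` has an open `V ∋ b`, `V ⊆ U`, carrying a
relative exponential chart of `p` all of whose fibre data over `V` satisfy `Q`, then — given any default values `Φd`, `exd` (used off `U`
only) — there is ONE relative exponential chart `(Φ, ex)` of `p` over `U` all of whose fibre data satisfy `Q`.  (Choose a chart at every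
point; rigidity makes every local chart agree with the pointwise choice; ★ `IsRelExpChartOn.of_local`.)  The rigidity in L7 is that of
admissible markings ([Milne2005ShimuraVarieties] Thm. 6.11, lemma of Serre).
[cite: BirkenhakeLange2004, §8.7] [cite: Milne2005ShimuraVarieties, §6 Thm. 6.11 p. 74] [cite: Shimura1963AnalyticFamilies, §2] -/
theorem exists_chart_of_local_of_rigid {Q : B → ((ι → ℝ) ≃L[ℝ] E) → (E → M) → Prop}
    (hrigid : ∀ b ∈ U, ∀ (Φ₁ Φ₂ : (ι → ℝ) ≃L[ℝ] E) (f₁ f₂ : E → M), Q b Φ₁ f₁ → Q b Φ₂ f₂ → Φ₁ = Φ₂ ∧ f₁ = f₂)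
    (hloc : ∀ b ∈ U, ∃ V : Set B, IsOpen V ∧ b ∈ V ∧ V ⊆ U ∧
      ∃ (Φ' : B → ((ι → ℝ) ≃L[ℝ] E)) (ex' : B × E → M), IsRelExpChartOn EB EM p V Φ' ex' ∧
        ∀ b' ∈ V, Q b' (Φ' b') (fun z => ex' (b', z)))
    (Φd : B → ((ι → ℝ) ≃L[ℝ] E)) (exd : B × E → M) :
    ∃ (Φ : B → ((ι → ℝ) ≃L[ℝ] E)) (ex : B × E → M), IsRelExpChartOn EB EM p U Φ ex ∧
      (∀ b ∈ U, Q b (Φ b) (fun z => ex (b, z))) ∧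
      (∀ b, b ∉ U → Φ b = Φd b) ∧ ∀ b, b ∉ U → ∀ z, ex (b, z) = exd (b, z) := by
  classical
  -- choose a chart at every point of `U` (junk elsewhere)
  have hch : ∀ b, ∃ (V : Set B) (Φ' : B → ((ι → ℝ) ≃L[ℝ] E)) (ex' : B × E → M), b ∈ U →
      IsOpen V ∧ b ∈ V ∧ V ⊆ U ∧ IsRelExpChartOn EB EM p V Φ' ex' ∧ ∀ b' ∈ V, Q b' (Φ' b') (fun z => ex' (b', z)) := by
    intro b
    by_cases hb : b ∈ U
    · obtain ⟨V, hVo, hbV, hVU, Φ', ex', hc, hQ⟩ := hloc b hb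
      exact ⟨V, Φ', ex', fun _ => ⟨hVo, hbV, hVU, hc, hQ⟩⟩
    · exact ⟨∅, Φd, exd, fun h => (hb h).elim⟩
  choose V Φc exc hV using hch
  -- the glued pair: at `b ∈ U` the fibre datum of the chart chosen AT `b`
  refine ⟨fun b => if b ∈ U then Φc b b else Φd b, fun q => if q.1 ∈ U then exc q.1 q else exd q, ?_, ?_, ?_, ?_⟩
  · refine of_local fun b hb => ?_
    obtain ⟨hVo, hbV, hVU, hc, hQ⟩ := hV b hb
    refine ⟨V b, hVo, hbV, hVU, Φc b, exc b, hc, fun b' hb' => ?_, fun b' hb' z => ?_⟩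
    · -- rigidity at `b'`: the chart chosen at `b` and the chart chosen at `b'` have the same fibre datum at `b'`
      have hb'U : b' ∈ U := hVU hb'
      obtain ⟨-, hb'V, -, -, hQ'⟩ := hV b' hb'U
      rw [if_pos hb'U]
      exact (hrigid b' hb'U _ _ _ _ (hQ b' hb') (hQ' b' hb'V)).1
    · have hb'U : b' ∈ U := hVU hb'
      obtain ⟨-, hb'V, -, -, hQ'⟩ := hV b' hb'U
      simp only [if_pos hb'U]
      exact congrFun (hrigid b' hb'U _ _ _ _ (hQ b' hb') (hQ' b' hb'V)).2 z
  · intro b hb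
    obtain ⟨-, hbV, -, -, hQ⟩ := hV b hb
    simp only [if_pos hb]
    exact hQ b hbV
  · intro b hb
    simp only [if_neg hb]
  · intro b hb z
    simp only [if_neg hb]

/-- **GLUING CHARTS WITH RIGID FIBRE DATA, without default bookkeeping** (the form the L7 socket consumes): under the hypotheses of
`exists_chart_of_local_of_rigid` there is a chart over `U` all of whose fibre data satisfy `Q`.
[cite: BirkenhakeLange2004, §8.7] [cite: Milne2005ShimuraVarieties, §6 Thm. 6.11 p. 74] -/
theorem exists_chart_of_local_of_rigid' {Q : B → ((ι → ℝ) ≃L[ℝ] E) → (E → M) → Prop}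
    (hrigid : ∀ b ∈ U, ∀ (Φ₁ Φ₂ : (ι → ℝ) ≃L[ℝ] E) (f₁ f₂ : E → M), Q b Φ₁ f₁ → Q b Φ₂ f₂ → Φ₁ = Φ₂ ∧ f₁ = f₂)
    (hloc : ∀ b ∈ U, ∃ V : Set B, IsOpen V ∧ b ∈ V ∧ V ⊆ U ∧
      ∃ (Φ' : B → ((ι → ℝ) ≃L[ℝ] E)) (ex' : B × E → M), IsRelExpChartOn EB EM p V Φ' ex' ∧
        ∀ b' ∈ V, Q b' (Φ' b') (fun z => ex' (b', z)))
    (Φd : B → ((ι → ℝ) ≃L[ℝ] E)) (exd : B × E → M) :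
    ∃ (Φ : B → ((ι → ℝ) ≃L[ℝ] E)) (ex : B × E → M), IsRelExpChartOn EB EM p U Φ ex ∧
      ∀ b ∈ U, Q b (Φ b) (fun z => ex (b, z)) := by
  obtain ⟨Φ, ex, hc, hQ, -, -⟩ := exists_chart_of_local_of_rigid hrigid hloc Φd exd
  exact ⟨Φ, ex, hc, hQ⟩

omit [TopologicalSpace B] [TopologicalSpace M] [ChartedSpace EB B] [ChartedSpace EM M] in
/-- **Fibre-map rigidity alone suffices when `Q` pins the period isomorphism pointwise** (the L7 shape: `Q` contains «`Φ_b = Π_{s b}`»):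
if `Q b Φ f → Φ = Per b` for a given family `Per` and the fibre maps are rigid, then `Q` is rigid in the sense of
`exists_chart_of_local_of_rigid`. [cite: Milne2005ShimuraVarieties, §6 Thm. 6.11 p. 74] -/
theorem rigid_of_period_eq_of_fibreMap_rigid {Q : B → ((ι → ℝ) ≃L[ℝ] E) → (E → M) → Prop} (Per : B → ((ι → ℝ) ≃L[ℝ] E))
    (hPer : ∀ b ∈ U, ∀ Φ f, Q b Φ f → Φ = Per b)
    (hf : ∀ b ∈ U, ∀ Φ₁ Φ₂ (f₁ f₂ : E → M), Q b Φ₁ f₁ → Q b Φ₂ f₂ → f₁ = f₂) :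
    ∀ b ∈ U, ∀ (Φ₁ Φ₂ : (ι → ℝ) ≃L[ℝ] E) (f₁ f₂ : E → M), Q b Φ₁ f₁ → Q b Φ₂ f₂ → Φ₁ = Φ₂ ∧ f₁ = f₂ :=
  fun b hb Φ₁ Φ₂ f₁ f₂ h₁ h₂ => ⟨(hPer b hb Φ₁ f₁ h₁).trans (hPer b hb Φ₂ f₂ h₂).symm, hf b hb Φ₁ Φ₂ f₁ f₂ h₁ h₂⟩

end Literature.Geometry.ComplexAnalytic.IsRelExpChartOn

end
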